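import Mathlib
import HarnessLib
import Summits.RiemannHypothesis.RiemannHypothesis.Theorems.RuelleBandAsymptoticCriticalLineHennionDecomposition
import Summits.RiemannHypothesis.RiemannHypothesis.Theorems.RuelleBandBandEngineCore
import Summits.RiemannHypothesis.RiemannHypothesis.Theorems.RuelleBandAsymptoticCriticalLineSpectralRadiusRH

/-!
# RuelleBand / `AsymptoticCriticalLine`: Hennion's quasi-compactness theorem, spectral form

Route `RiemannHypothesis/RuelleBand`, crux item stmt-RiemannHypothesis-2063
(`AsymptoticCriticalLine`), line `interior-edge-split`, helper file (`--supports`; registered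
periphery stub `hennion_quasiCompact`). Everything is proved; no definitions.

Informal statement. Let `H` be a complex Hilbert space, `A : H → H` a bounded operator, `w` a
seminorm on `H` whose restriction to the unit ball is totally bounded (for every `η > 0` there is
a finite `F ⊆ H` such that every `f` with `‖f‖ ≤ 1` has `w(f - g) < η` for some `g ∈ F`), and
`r ≥ 0` a rate such that for every `ε > 0` the iterated two-norm (Doeblin–Fortet / Lasota–Yorke)
inequalities `‖Aⁿ f‖ ≤ C_ε (r + ε)ⁿ ‖f‖ + R_{n,ε} w(f)` hold for all `n`. Then for every `r' > r`
the spectrum of `A` contains only finitely many points of modulus `≥ r'`, and at each of them the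
eigenspace `ker (A - μ)` is finite-dimensional. This is the quasi-compactness theorem of
Ionescu-Tulcea–Marinescu and Hennion ("the essential spectral radius of `A` is at most `r`";
Nussbaum's formula for the essential spectral radius), in the Hilbert-space case and with the
conclusion phrased without the words "essential spectrum" (Mathlib has none): finitely many
spectral points of modulus `≥ r'` and finite-dimensional eigenspaces there.

Proof. Choose `ε > 0` with `r + ε < r'` and a power `N = n + 1` with `C_ε (r + ε)^N < r'^N / 4`
(`exists_pow_mul_lt`); the landed one-step decomposition `hennion_decomposition` applied to `A^N`
(inequality `‖A^N f‖ ≤ ρ ‖f‖ + R w(f)` with `ρ := C_ε (r + ε)^N`, slack `r'^N / 4`) gives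
`A^N = S + K` with `K` compact and `‖S‖ < r'^N`. On the exterior `D := {ρ₀ < ‖ν‖}`
(`‖S‖ ≤ ρ₀ < r'^N`; open, connected by `RuelleBand.isConnected_exterior`, inside the resolvent
set of `S`, and containing the far-out resolvent point `‖A^N‖ ‖1‖ + r'^N` of `A^N`) the analytic
Fredholm alternative (tree: `spectrum_add_compact_isolated_eigenvalues`, Reed–Simon I Thm VI.14)
makes the spectrum of `S + K = A^N` discrete, hence finite on the compact annulus
`{r'^N ≤ ‖ν‖ ≤ ‖A^N‖ ‖1‖}` (`RuelleBand.finite_spectrum_inter_of_isolated`), which carries all of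
`σ(A^N) ∩ {r'^N ≤ ‖ν‖}`; and the eigenspaces of `S + K` at points of `D` are finite-dimensional
(`RuelleBand.finiteDimensional_eigenspace_add_compact`, Riesz). Pull back along `μ ↦ μ^N`:
`σ(A) ∩ {r' ≤ ‖μ‖}` maps into that finite set (spectral mapping, `spectrum.pow_mem_pow`) with
finite fibres (the `N`-th roots, `Polynomial.nthRootsFinset`), and `ker (A - μ) ≤ ker (A^N - μ^N)`.

Sources: H. Hennion, "Sur un théorème spectral et son application aux noyaux lipchitziens",
Proc. Amer. Math. Soc. 118 (1993) 627–634; C. T. Ionescu Tulcea – G. Marinescu, "Théorie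
ergodique pour des classes d'opérations non complètement continues", Ann. of Math. 52 (1950)
140–147; R. D. Nussbaum, "The radius of the essential spectrum", Duke Math. J. 37 (1970)
473–478.
-/

noncomputable section

-- D-0017: `Summit.<S>.<S>.…` is the designed namespace of a single-problem summit.
set_option linter.dupNamespace false

namespace Summit.RiemannHypothesis.RiemannHypothesis.Theorems

open Complex Filter Topology Set Metric
open Literature.Analysis.OperatorTheory

/-- The fibres of `μ ↦ μ ^ N` (`N ≥ 1`) over `ℂ` are finite: at most `N` roots. [folklore] -/
theorem finite_preimage_pow_singleton {N : ℕ} (hN : 0 < N) (b : ℂ) :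
    ((fun μ : ℂ => μ ^ N) ⁻¹' {b}).Finite :=
  (Polynomial.nthRootsFinset N b).finite_toSet.subset fun _ hμ =>
    Finset.mem_coe.2 ((Polynomial.mem_nthRootsFinset hN b).2
      (Set.mem_singleton_iff.1 (Set.mem_preimage.1 hμ)))

/-- A geometric sequence of smaller ratio eventually beats any constant multiple of a larger one:
if `0 ≤ s < r'` and `0 < C`, then `C * s ^ (n + 1) < r' ^ (n + 1) / 4` for some `n`. [folklore] -/
theorem exists_pow_mul_lt {s r' C : ℝ} (hs : 0 ≤ s) (hsr : s < r') (hC : 0 < C) :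
    ∃ n : ℕ, C * s ^ (n + 1) < r' ^ (n + 1) / 4 := by
  have hr' : 0 < r' := lt_of_le_of_lt hs hsr
  set q : ℝ := s / r' with hqdef
  have hq0 : 0 ≤ q := div_nonneg hs hr'.le
  have hq1 : q < 1 := (div_lt_one hr').2 hsr
  obtain ⟨n, hn⟩ := exists_pow_lt_of_lt_one (show 0 < 1 / (4 * C) by positivity) hq1
  refine ⟨n, ?_⟩
  have hqN : q ^ (n + 1) ≤ q ^ n := pow_le_pow_of_le_one hq0 hq1.le (Nat.le_succ n)
  have h4 : 4 * C * q ^ n < 1 := by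
    have h := (lt_div_iff₀ (show (0 : ℝ) < 4 * C by positivity)).1 hn
    linarith
  have hP : 0 < r' ^ (n + 1) := pow_pos hr' _
  have hsq : s ^ (n + 1) = q ^ (n + 1) * r' ^ (n + 1) := by
    rw [hqdef, div_pow, div_mul_cancel₀ _ (pow_ne_zero _ hr'.ne')]
  rw [hsq]
  calc C * (q ^ (n + 1) * r' ^ (n + 1)) ≤ C * (q ^ n * r' ^ (n + 1)) :=
        mul_le_mul_of_nonneg_left (mul_le_mul_of_nonneg_right hqN hP.le) hC.le
    _ = (4 * C * q ^ n) * r' ^ (n + 1) / 4 := by ring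
    _ < 1 * r' ^ (n + 1) / 4 := by gcongr
    _ = r' ^ (n + 1) / 4 := by rw [one_mul]

/-- **Hennion's quasi-compactness theorem (spectral form, Hilbert-space case).** Let `A` be a
bounded operator on a complex Hilbert space `H`, `w` a seminorm on `H` whose restriction to the
unit ball is totally bounded, and `r ≥ 0` a rate such that for every `ε > 0` the iterated two-norm
inequalities `‖Aⁿ f‖ ≤ C_ε (r + ε)ⁿ ‖f‖ + R_{n,ε} w(f)` hold. Then for every `r' > r` the spectrum
of `A` has only finitely many points `μ` with `‖μ‖ ≥ r'`, and at every such point the eigenspace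
`ker (A - μ)` is finite-dimensional (Ionescu-Tulcea–Marinescu 1950, Hennion 1993: the essential
spectral radius of `A` is at most `r`). [folklore] -/
theorem hennion_quasiCompact :
    ∀ (H : Type) (_ : NormedAddCommGroup H) (_ : InnerProductSpace ℂ H) (_ : CompleteSpace H) (A : H →L[ℂ] H) (w : Seminorm ℂ H) (r : ℝ), 0 ≤ r → (∀ η : ℝ, 0 < η → ∃ F : Finset H, ∀ f : H, ‖f‖ ≤ 1 → ∃ g ∈ F, w (f - g) < η) → (∀ ε : ℝ, 0 < ε → ∃ C : ℝ, ∀ n : ℕ, ∃ R : ℝ, ∀ f : H, ‖(A ^ n) f‖ ≤ C * (r + ε) ^ n * ‖f‖ + R * w f) → ∀ r' : ℝ, r < r' → (spectrum ℂ A ∩ {μ : ℂ | r' ≤ ‖μ‖}).Finite ∧ ∀ μ : ℂ, μ ∈ spectrum ℂ A → r' ≤ ‖μ‖ → FiniteDimensional ℂ (LinearMap.ker ((A - μ • (1 : H →L[ℂ] H) : H →L[ℂ] H) : H →ₗ[ℂ] H)) := by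
  intro H _ _ _ A w r hr hw hLY r' hr'
  -- (1) a rate `r + ε < r'` and the constant `C' ≥ 1` of the a-priori inequality at rate `ε`
  obtain ⟨ε, hε, hεr⟩ : ∃ ε : ℝ, 0 < ε ∧ r + ε < r' := ⟨(r' - r) / 2, by linarith, by linarith⟩
  have hr'pos : 0 < r' := by linarith
  obtain ⟨C, hC⟩ := hLY ε hε
  set C' : ℝ := max C 1 with hC'def
  have hC'pos : 0 < C' := lt_of_lt_of_le one_pos (le_max_right C 1)
  -- (2) a power `N = n + 1` with `C' (r + ε)^N < r'^N / 4`
  obtain ⟨n, hn⟩ := exists_pow_mul_lt (by linarith : 0 ≤ r + ε) hεr hC'pos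
  set P : ℝ := r' ^ (n + 1) with hPdef
  have hPpos : 0 < P := pow_pos hr'pos _
  set ρ : ℝ := C' * (r + ε) ^ (n + 1) with hρdef
  have hρ0 : 0 ≤ ρ := by positivity
  have hρP : ρ < P / 4 := hn
  obtain ⟨R, hR⟩ := hC (n + 1)
  set R' : ℝ := max R 0 with hR'def
  have hLY1 : ∀ f : H, ‖(A ^ (n + 1)) f‖ ≤ ρ * ‖f‖ + R' * w f := by
    intro f
    have h := hR f
    have hw0 : 0 ≤ w f := apply_nonneg w f
    have hs0 : 0 ≤ (r + ε) ^ (n + 1) := by positivity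
    have h1 : C * (r + ε) ^ (n + 1) * ‖f‖ ≤ ρ * ‖f‖ :=
      mul_le_mul_of_nonneg_right (mul_le_mul_of_nonneg_right (le_max_left C 1) hs0)
        (norm_nonneg f)
    have h2 : R * w f ≤ R' * w f := mul_le_mul_of_nonneg_right (le_max_left R 0) hw0
    linarith
  -- (3) Hennion's decomposition of `A ^ N`: `A ^ N = S + K`, `K` compact, `‖S‖ < r'^N`
  obtain ⟨S, K, hSK, hK, hS⟩ := hennion_decomposition H inferInstance inferInstance inferInstance
    (A ^ (n + 1)) w ρ R' (P / 4) hρ0 (le_max_right R 0) (by positivity) hLY1 hw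
  have hSP : ‖S‖ < P := by linarith
  -- (4) the exterior domain `D = {ρ₀ < ‖ν‖}`, `‖S‖ ≤ ρ₀ < r'^N`
  set ρ₀ : ℝ := max ‖S‖ (P / 2) with hρ₀def
  have hρ₀pos : 0 < ρ₀ := lt_of_lt_of_le (by positivity) (le_max_right _ _)
  have hρ₀P : ρ₀ < P := max_lt hSP (by linarith)
  have hSρ₀ : ‖S‖ ≤ ρ₀ := le_max_left _ _
  set D : Set ℂ := {ν : ℂ | ρ₀ < ‖ν‖} with hDdef
  have hD : IsOpen D := isOpen_lt continuous_const continuous_norm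
  have hDc : IsConnected D := by
    have h := RuelleBand.isConnected_exterior (Real.log ρ₀)
    rw [Real.exp_log hρ₀pos] at h
    exact h
  have hDS : D ⊆ resolventSet ℂ S := by
    intro ν hν
    rw [spectrum.mem_resolventSet_iff, ← spectrum.notMem_iff]
    intro hνσ
    have h1 : ‖ν‖ ≤ ‖S‖ * ‖(1 : H →L[ℂ] H)‖ := spectrum.norm_le_norm_mul_of_mem hνσ
    have h2 : ‖(1 : H →L[ℂ] H)‖ ≤ 1 := ContinuousLinearMap.norm_id_le
    have h3 : ‖S‖ * ‖(1 : H →L[ℂ] H)‖ ≤ ‖S‖ := by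
      calc ‖S‖ * ‖(1 : H →L[ℂ] H)‖ ≤ ‖S‖ * 1 := mul_le_mul_of_nonneg_left h2 (norm_nonneg _)
        _ = ‖S‖ := mul_one _
    have h4 : ρ₀ < ‖ν‖ := hν
    linarith
  -- (5) a resolvent point of `A ^ N = S + K` far out in `D`
  have hbound : ∀ ν ∈ spectrum ℂ (A ^ (n + 1)), ‖ν‖ ≤ ‖A ^ (n + 1)‖ * ‖(1 : H →L[ℂ] H)‖ :=
    fun ν hν => spectrum.norm_le_norm_mul_of_mem hν
  set M : ℝ := ‖A ^ (n + 1)‖ * ‖(1 : H →L[ℂ] H)‖ with hMdef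
  have hM0 : 0 ≤ M := by positivity
  set ν₀ : ℂ := ((M + P : ℝ) : ℂ) with hν₀def
  have hν₀n : ‖ν₀‖ = M + P := by
    rw [hν₀def, Complex.norm_real, Real.norm_of_nonneg (by linarith)]
  have hν₀D : ν₀ ∈ D := by
    show ρ₀ < ‖ν₀‖
    rw [hν₀n]
    linarith
  have hν₀ρ : ν₀ ∈ resolventSet ℂ (S + K) := by
    rw [← hSK, spectrum.mem_resolventSet_iff, ← spectrum.notMem_iff]
    intro hσ
    have h := hbound ν₀ hσ
    rw [hν₀n] at h
    linarith
  obtain ⟨h1, -⟩ := spectrum_add_compact_isolated_eigenvalues S K hK hD hDc hDS hν₀D hν₀ρ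
  -- (6) finitely many spectral points of `A ^ N` of modulus `≥ r'^N`
  set Cset : Set ℂ := {ν : ℂ | P ≤ ‖ν‖ ∧ ‖ν‖ ≤ M} with hCdef
  have hCc : IsCompact Cset := by
    refine (isCompact_closedBall (0 : ℂ) M).of_isClosed_subset ?_ ?_
    · exact (isClosed_le continuous_const continuous_norm).inter
        (isClosed_le continuous_norm continuous_const)
    · rintro ν ⟨-, h2⟩; simpa using h2
  have hCD : Cset ⊆ D := fun ν hν => lt_of_lt_of_le hρ₀P hν.1
  have hfinSK : (spectrum ℂ (S + K) ∩ Cset).Finite :=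
    RuelleBand.finite_spectrum_inter_of_isolated (S + K) h1 hCc hCD
  have hF : (spectrum ℂ (A ^ (n + 1)) ∩ {ν : ℂ | P ≤ ‖ν‖}).Finite := by
    refine hfinSK.subset ?_
    rintro ν ⟨hνσ, hνP⟩
    exact ⟨hSK ▸ hνσ, hνP, hbound ν hνσ⟩
  -- (7) pull back along `μ ↦ μ ^ N`
  have hpow : ∀ μ : ℂ, r' ≤ ‖μ‖ → P ≤ ‖μ ^ (n + 1)‖ := fun μ hμ => by
    rw [norm_pow]
    exact pow_le_pow_left₀ hr'pos.le hμ (n + 1)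
  refine ⟨?_, fun μ hμ hμr => ?_⟩
  · have hpre : ((fun μ : ℂ => μ ^ (n + 1)) ⁻¹'
        (spectrum ℂ (A ^ (n + 1)) ∩ {ν : ℂ | P ≤ ‖ν‖})).Finite :=
      hF.preimage' fun b _ => finite_preimage_pow_singleton (Nat.succ_pos n) b
    refine hpre.subset ?_
    rintro μ ⟨hμσ, hμr⟩
    exact ⟨spectrum.pow_mem_pow A (n + 1) hμσ, hpow μ hμr⟩
  · have hμD : μ ^ (n + 1) ∈ D := lt_of_lt_of_le hρ₀P (hpow μ hμr)
    haveI := RuelleBand.finiteDimensional_eigenspace_add_compact S K hK (hDS hμD)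
    refine Submodule.finiteDimensional_of_le
      (S₂ := LinearMap.ker ((S + K - μ ^ (n + 1) • (1 : H →L[ℂ] H) : H →L[ℂ] H) : H →ₗ[ℂ] H))
      ?_
    intro v hv
    rw [LinearMap.mem_ker] at hv ⊢
    simp only [ContinuousLinearMap.coe_coe] at hv ⊢
    have e1 : (A - μ • (1 : H →L[ℂ] H)) v = A v - μ • v := rfl
    rw [e1, sub_eq_zero] at hv
    have e2 : (S + K - μ ^ (n + 1) • (1 : H →L[ℂ] H)) v = (S + K) v - μ ^ (n + 1) • v := rfl
    rw [e2, ← hSK, ContinuousLinearMap.pow_apply_eq_pow_smul A hv (n + 1), sub_self]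

end Summit.RiemannHypothesis.RiemannHypothesis.Theorems

end
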